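import Literature.MathematicalPhysics.QuantumFieldTheory.Balaban1983to89.B6HolderTermMultiLevelBoxL0
import Literature.MathematicalPhysics.QuantumFieldTheory.Balaban1983to89.B6Prop22HolderMultiLevelBox
/-!
# `Balaban1983to89.B6Prop22HolderMultiLevelBoxL0` — LEVEL-0 TWIN (programme G-F3′-L0, director-ym LINE №27 / UV3-NODE §24.5; plan `lit-balaban-r03/G-F3L0-PLAN.md`) of `B6Prop22HolderMultiLevelBox`:
the same declarations, SAME NAMES AND STATEMENTS, for nested families WITH print's region `Λ₀ = T ∖ Ω₁` ADMITTED (structures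
`B6MultiLevelBoxOperatorL0.Domains` / `B6MultiLevelTorusOperatorL0.TDomains`: levels `0, …, k`, the level-`0` block a single site, `Q′₀ = id`,
finite weight `a₀` — print p.225 (2.14) «Σ_{j=0}^k … (Q′₀λ)(x) = λ(x), x ∈ Λ₀», p.229 «taking a sequence (2.1) … smallest possible domains B^j(Λ_j),
and considering the operator Δ_a defined by (2.19), (2.20) for this sequence»).  Every `D`-free object is the lineage's, consumed BY NAME; no existing
module is touched; no fact is minted.  Unit `lit-balaban-p21` (packet S-B owner, p21 gen 26; port tooling by r03 gen 36); B6 fold owner r03; referee ref-4.  THE TWIN'S DOCUMENTATION FOLLOWS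
VERBATIM (its «levels 1 … k» / «Ω₁ = X» sentences describe the twin; here `j` runs from `0` and `Ω₁` may be a proper subset).

# `Balaban1983to89.B6Prop22HolderMultiLevelBox` — [B6] PROPOSITION 2.2, FOURTH ENTRY OF (2.67) (`‖ζ∇^η_xG′λ‖_α`), FOR
THE GENUINE `k`-LEVEL OPERATOR `G′ = Δ′_a^{−1}` ON A BOX:
`|x′−x|^{−α}|((∇^η_μG′λ)(x′) − (∇^η_μG′λ)(x))| ≤ O(1)(L^jη)^{1−α}e^{−½δ₀d(y,y′)}|λ|`, `x, x′ ∈ B^j(y)`, `supp λ ⊂ B^{j′}(y′)` —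
by the printed route (2.64)–(2.66) applied to the fixed point `∇G′ = ∇G′₀ + (∇G′)R` differenced over pairs and LIFTED
to the index set `pairs ⊕ sites` (file 11 of the multi-level parametrix; no existing module is touched; no fact is minted)

FRAMING (verbatim cell line):
statement-level skeleton of published theorems with citation tags; proofs where landed; nothing here is a claim about the Yang–Mills mass gap

Source under audit (cell pub-balaban / lit-balaban): T. Bałaban, *Propagators and renormalization transformations for
lattice gauge theories. II*, Commun. Math. Phys. **96** (1984) 223–250 [`Balaban1984PropagatorsII`, "B6"], p. 234
[PDF 12] (2.64)–(2.67), Proposition 2.2; p. 232 [PDF 10] (2.51)–(2.55) (renders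
`run/shared/lean/pub/pub-balaban/b2b-balaban-ref1/pages/1984-cmp96-propagators-rt-II/…-p010/p012-x2.png`); [3] =
T. Bałaban, *Regularity and decay of lattice Green's functions*, Commun. Math. Phys. **89** (1983) 571–597
[`Balaban1983RegularityDecay`], Theorem (1.9) p. 573.  Unit `lit-balaban-p21` (Phase-2 proof seat p21 gen 11), HOME
`run/shared/lean/pub/lit-balaban/`, B6 fold owner r03, referee ref-4.

## WHAT IS PRINTED (p. 234, verbatim up to notation)

«… |(G′λ)(x)| ≤ Σ_{n=0}^∞ |(G′₀Rⁿλ)(x)| ≤ O(1)(L^jη)² e^{−½δ₀d(y,y′)}|λ|. (2.66)  The similar inequalities hold for a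
derivative of G′λ and for a Hölder norm of a derivative, but with (L^jη)² replaced by L^jη and (L^jη)^{1−α}
correspondingly. Let us formulate these results in Proposition 2.2. If we have (2.1), (2.2) and M is sufficiently
large, then the operator G′ = Δ′_a^{−1}(a = 1) satisfies the inequalities |(G′λ)(x)|, |(∇^η_xG′λ)(x)|,
|(G′∇^{η*}λ)(x)|, ‖ζ∇^η_xG′λ‖_α, ‖ζG′∇^{η*}λ‖_α, |(Δ^ηG′λ)(x)| ≤ O(1)[(L^jη)², L^jη, L^jη, (L^jη)^{1−α}(‖ζ‖_α + |ζ|),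
(L^jη)^{1−α}(‖ζ‖_α + |ζ|), 1]·e^{−½δ₀d(y,y′)}|λ|, x ∈ B^j(y) or supp ζ ⊂ B^j(y), y ∈ Λ_j, supp λ ⊂ B^{j′}(y′),
y′ ∈ Λ_{j′}. (2.67)»; p. 230: «Properties of the operators G′_j(□), G′_j(□)Q′_j* and C_Λ^{(j)}(□) are described in
Lemmas 2.2, 2.4, Proposition 2.3 [3]. From these and (2.42) we get» (2.43) — the cube estimates come from [3], whose
Theorem (1.9) (p. 573) is the Hölder estimate `|x−x′|^{−α}|(∇G(x,y) − ∇G(x′,y))| ≤ …` «without any restrictions on the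
points x, x′» (docfix: the sentence of p. 230 quoted verbatim, referee NOTE S-B6-g41-2; no declaration changed).

## WHAT THIS FILE CERTIFIES (kernel-checked; setting of files 1–6 and 10)

* §1 **PAIR-ROWED FUNCTIONALS INSIDE THE MAJORANT CALCULUS** of `B6RandomWalk`: for a linear map `A : (X → ℝ) →ₗ (Y → ℝ)`
  (rows indexed by a second type `Y`, here pairs of sites) the lifts `liftL A`, `liftR R` to endomorphisms of
  `(Y ⊕ X) → ℝ`, `liftL A · liftR R = liftL (A ∘ R)`, and the transfer of majorants in both directions
  (`hasMajorant_liftR`, `hasMajorant_liftL`, `rowBound_of_hasMajorant_liftL`) — the dictionary by which a fixed point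
  `T = T₀ + T·R` of a `Y`-rowed functional of `G′` is a fixed point of endomorphisms, so that the chain
  `B6Prop23Chain.majorant_of_fixedPoint_266W` applies verbatim;
* §2 the pairs `x ≠ x′` of one block with `x+e_μ, x′+e_μ` in the box (`HPair`), the Hölder-weighted mixed difference
  `(Dd f)(x,x′) = |x′−x|_∞^{−α}((f(x′+e_μ) − f(x′)) − (f(x+e_μ) − f(x)))`, the functional `T(M) = Dd ∘ M` (`holderOp`) and
  **THE LIFTED FIXED POINT** `liftL T(G′) = liftL T(G′₀) + liftL T(G′)·liftR R` from `G′ = G′₀ + G′R` ((2.38)/(2.50),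
  `fixedPoint_holder`);
* §3 **THE PAIR-ROW BOUND OF `T(G′₀)`** `holderZero_rowBound`:
  `|T(G′₀)λ(x,x′)| ≤ A·(L^{j})^{1−α}·e^{−δ₅d(y,y′)/(d+1)}|λ|` — the terms of `G′₀ = Σ_□ h_□G′(□)v_□` one by one (file 10
  `B6HolderTermMultiLevelBoxL0.aX_dd_le`), at most `12·2^{d+1}` of them meeting the four points;
* §4 **PROPOSITION 2.2, FOURTH ENTRY, FOR THE GENUINE `k`-LEVEL OPERATOR**: `hasMajorant_holder_multiLevelBox` (the lift
  of `T(G′)` has the majorant `C·(L^{j})^{1−α}·e^{−½δ₀d(y,y′)}` on `𝔅`: the majorants of `R` ((2.64), file 5) and of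
  `T(G′₀)` (§3), Lemma 2.1 on the box (file 4), the chain on `pairs ⊕ sites`) and the printed form
  `prop22_fourth_multiLevelBox`: for `0 ≤ α < 1` there are `δ₀, C, M₀ > 0`, `N₀ ≥ 1` such that for every `k`, `M_h ≥ 3`
  with `L·M_h ≥ M₀`, `R ≥ 2L` with `RM ≥ N₀ + 1`, volume, nested family `D`, weights in the windows with
  `a_{i+1} = aNext ℓ a_i c_i`, axis `μ`, `λ` supported in `B^{j′}(y′)` and all `x ≠ x′` of one block `B^j(y)` with
  `x+e_μ, x′+e_μ` in the box:
  `|x′−x|_∞^{−α}·|((G′λ)(x′+e_μ) − (G′λ)(x′)) − ((G′λ)(x+e_μ) − (G′λ)(x))| ≤ C·(L^{j})^{1−α}·e^{−½δ₀d(y,y′)}·sup|λ|`.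

## HONEST SCOPE

As files 1–6 and 10: levels `1 … k` on a Neumann box, `m² = 0`, the asymmetric partition, `M_h ≥ 3`, `R ≥ 2L`; lattice
units (`G′` here is `η^{−2}G′` of print and the differences are `η∇^η`, whence `(L^{j})^{1−α}` for «(L^jη)^{1−α}»);
the Hölder quotient of `∇^η_μG′λ` is taken over the pairs of ONE block `B^j(y)` (print: «supp ζ ⊂ B^j(y)»), the
cut-off `ζ` and the factor `(‖ζ‖_α + |ζ|)` being dispensed with as in [3] (1.9); `0 ≤ α < 1` with rate and constants
depending on `α`; the (2.61)-constant is the `L`-dependent series constant of `B6Ineq261LevelGap`; constants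
existential.  The fifth entry `‖ζG′∇^{η*}λ‖_α` for the `k`-level operator is NOT treated here.  Nothing is inferred
from the manuscript: every step is kernel-checked.
-/

namespace Literature.MathematicalPhysics.QuantumFieldTheory.Balaban1983to89.B6Prop22HolderMultiLevelBoxL0

open Finset Matrix
open Literature.MathematicalPhysics.QuantumFieldTheory.Balaban1983to89.B4ContourShift (supNorm supNorm_nonneg
  abs_le_supNorm exists_supNorm_eq)
open Literature.MathematicalPhysics.QuantumFieldTheory.Balaban1983to89.B4Reflection242 (boxDom mem_boxDom blk nbrs
  mem_nbrs)
open Literature.MathematicalPhysics.QuantumFieldTheory.Balaban1983to89.B4Lemma22ReduceZero (Box)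
open Literature.MathematicalPhysics.QuantumFieldTheory.Balaban1983to89.B4PartitionUnity22 (hprof D1 D2 D1_nonneg D2_nonneg
  contDiff_hprof hasCompactSupport_hprof)
open Literature.MathematicalPhysics.QuantumFieldTheory.Balaban1983to89.B4Thm110ZeroBox (boxCast boxCast_apply_val
  boxCast_symm_apply_val mem_boxDom_of_eq roww mulVec_le_of_roww supNorm_sub_le_sub_add_sub)
open Literature.MathematicalPhysics.QuantumFieldTheory.Balaban1983to89.B4Thm110ZeroBoxDeriv (wsum supNorm_single_le
  supNorm_sub_le_nbr)
open Literature.MathematicalPhysics.QuantumFieldTheory.Balaban1983to89.B6Ineq243TwoLevelBox hiding ineq243_twoLevel_deriv_value ineq243_twoLevel_deriv_wsum ineq243_twoLevel_dist ineq243_twoLevel_rowSum_colSum ineq243_twoLevel_roww ineq243_twoLevel_value ineq244_twoLevel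
open Literature.MathematicalPhysics.QuantumFieldTheory.Balaban1983to89.B6Ineq243TwoLevelBoxL0
open Literature.MathematicalPhysics.QuantumFieldTheory.Balaban1983to89.B6Partition236TwoLevelBox
open Literature.MathematicalPhysics.QuantumFieldTheory.Balaban1983to89.B6Eq238TwoLevelBox
open Literature.MathematicalPhysics.QuantumFieldTheory.Balaban1983to89.B6Ineq249TwoLevelBox (near card_near_le
  mem_near_of_abs_lt emb_sub_emb)
open Literature.MathematicalPhysics.QuantumFieldTheory.Balaban1983to89.B6MultiLevelBoxOperator hiding Domains mlOp_apply
open Literature.MathematicalPhysics.QuantumFieldTheory.Balaban1983to89.B6MultiLevelBoxOperatorL0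
open Literature.MathematicalPhysics.QuantumFieldTheory.Balaban1983to89.B6Eq238MultiLevelBox hiding Active CubeData Down Ep LamG aX bX cG cOp cOp_mul_cG ctrs_Pj_subset cubeData_of_mem cubeSet diagonal_mul_eq_pad eq238_multiLevelBox fin fin_data fin_spec gX gZeroML isBlockUnion_LamG lev_corner_ublk mem_LamG mem_cubeSet mlOp_emb_emb mlOp_emb_off mlOp_mul_aX mlOp_mul_term rML row_eq_pad_row sum_uv_eq_one vFun vX window_of_active
open Literature.MathematicalPhysics.QuantumFieldTheory.Balaban1983to89.B6Eq238MultiLevelBoxL0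
open Literature.MathematicalPhysics.QuantumFieldTheory.Balaban1983to89.B6Ineq249MultiLevelBox hiding abs_vFun_le_one bX_eq bX_mulVec_apply embC eq250_multiLevelBox innerB local_comm_bound mem_keySet_of_bX_ne_zero norm_rML_le
open Literature.MathematicalPhysics.QuantumFieldTheory.Balaban1983to89.B6Ineq249MultiLevelBoxL0
open Literature.MathematicalPhysics.QuantumFieldTheory.Balaban1983to89.B6Geom246MultiLevelBox hiding Touch blkOf blkOf_corner blkOf_eq_iff_blk blkOf_eq_of_blk_i_eq blkOf_val bond bond_adj bset cen connected coord_bounds corner corner_mem csys dist_blkOf_le_box dist_blkOf_le_coord dist_blkOf_le_line dist_cen_le_of_adj dist_cen_le_of_touch dist_le_one_of_near dist_toR_cen_le exists_blkOf_eq geom lemma21_box lev_corner lev_eq_of_blkOf_eq levelGap pack reachable_blkOf reachable_of_near realizes scale_bounds touch_symm triangle_refl_nonneg walk_disp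
open Literature.MathematicalPhysics.QuantumFieldTheory.Balaban1983to89.B6Geom246MultiLevelBoxL0
open Literature.MathematicalPhysics.QuantumFieldTheory.Balaban1983to89.B6Prop22MultiLevelBox hiding Dd_le_supNorm aX_mulVec_apply bX_row_img bX_row_off dist_blkOf_le_in_cube fixedPoint_gml gX_row_img gX_row_off gZeroML_majorant lev_window_of_inCube mem_keySet_of_aX_ne_zero prop22_first_multiLevelBox rML_majorant
open Literature.MathematicalPhysics.QuantumFieldTheory.Balaban1983to89.B6Prop22MultiLevelBoxL0
open Literature.MathematicalPhysics.QuantumFieldTheory.Balaban1983to89.B6Prop22DerivMultiLevelBox (dMat dMat_mulVec_of_mem)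
open Literature.MathematicalPhysics.QuantumFieldTheory.Balaban1983to89.B6Prop22DerivMultiLevelBoxL0 (img_of_uX_ne_zero mem_keySet_of_uX_ne_zero)
open Literature.MathematicalPhysics.QuantumFieldTheory.Balaban1983to89.B6Prop22HolderTwoLevelBox (exists_emb_eq_of_near
  abs_hq_dd_le wsum_longDiff_le)
open Literature.MathematicalPhysics.QuantumFieldTheory.Balaban1983to89.B6Ineq243HolderTwoLevelBox
  (ineq243_twoLevel_holder_wsum2)
open Literature.MathematicalPhysics.QuantumFieldTheory.Balaban1983to89.B6RandomWalk (HasMajorant BlockSupp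
  hasMajorant_mono)
open Literature.MathematicalPhysics.QuantumFieldTheory.Balaban1983to89.B6Ineq261LevelGap (K261 K261_nonneg
  theta_lt_one_of_log)
open Literature.MathematicalPhysics.QuantumFieldTheory.Balaban1983to89.B6Prop23Chain (majorant_of_fixedPoint_266W)
open Literature.MathematicalPhysics.QuantumFieldTheory.Balaban1983to89.B6HolderTermMultiLevelBoxL0 (aX_dd_le)

open Literature.MathematicalPhysics.QuantumFieldTheory.Balaban1983to89.B6Prop22HolderMultiLevelBox (liftL liftR liftL_apply_inl liftL_apply_inr liftR_apply_inl liftR_apply_inr liftL_mul_liftR liftL_add hasMajorant_liftR hasMajorant_liftL rowBound_of_hasMajorant_liftL)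
noncomputable section

variable {d : ℕ}

/-! ## §0 Tools -/

section Tools

/-- a sum over a finite type whose non-zero terms are indexed injectively into a finset `T` and are bounded by
`B ≥ 0` is at most `|T|·B`. [folklore] -/
private theorem sum_le_card_mul {ι σ : Type*} [Fintype ι] [DecidableEq σ] (f : ι → ℝ) (key : ι → σ)
    (hkey : Function.Injective key) (T : Finset σ) (hT : ∀ i, f i ≠ 0 → key i ∈ T) {B : ℝ} (hB : 0 ≤ B)
    (hf : ∀ i, f i ≤ B) : ∑ i, f i ≤ T.card * B := by
  classical
  rw [← Finset.sum_filter_ne_zero]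
  have hcard : (Finset.univ.filter fun i => f i ≠ 0).card ≤ T.card :=
    Finset.card_le_card_of_injOn key (fun i hi => by
      rw [Finset.coe_filter] at hi; exact hT i hi.2) (fun i _ j _ h => hkey h)
  calc ∑ i ∈ Finset.univ.filter (fun i => f i ≠ 0), f i
      ≤ (Finset.univ.filter fun i => f i ≠ 0).card • B := Finset.sum_le_card_nsmul _ _ _ fun i _ => hf i
    _ = ((Finset.univ.filter fun i => f i ≠ 0).card : ℝ) * B := by rw [nsmul_eq_mul]
    _ ≤ T.card * B := mul_le_mul_of_nonneg_right (by exact_mod_cast hcard) hB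

end Tools

/-! ## §1 Pair-rowed functionals inside the majorant calculus -/

section Lift

variable {g : B6.Geometry} {X Y : Type}

variable (blkX : X → g.Site) (blkY : Y → g.Site)

end Lift

/-! ## §2 The same-block pairs of a bond direction, the Hölder-weighted mixed difference, the lifted fixed point -/

section Pairs

variable {ℓ Mh k R : ℕ} {P : Fin (d + 1) → ℕ}

/-- **THE PAIRS `x ≠ x′` OF ONE BLOCK OF `𝔅` WITH `x + e_μ`, `x′ + e_μ` IN THE BOX** (the two points of the Hölder
quotient of `∇^η_μG′λ`, «x, x′ ∈ B^j(y)» / «supp ζ ⊂ B^j(y)»). [cite: Balaban1984PropagatorsII, (2.67) p.234 (the Hölder entries), dictionary] -/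
structure HPair (D : Domains d ℓ Mh k P R) (μ : Fin (d + 1)) where
  /-- the first point -/
  x : ↥(boxDom (N0 ℓ Mh k P))
  /-- the second point -/
  x' : ↥(boxDom (N0 ℓ Mh k P))
  /-- the points differ -/
  ne : x'.1 ≠ x.1
  /-- the points lie in one block of `𝔅` -/
  blk : blkOf D x' = blkOf D x
  /-- `x + e_μ` lies in the box -/
  hxe : x.1 + Pi.single μ 1 ∈ boxDom (N0 ℓ Mh k P)
  /-- `x′ + e_μ` lies in the box -/
  hxe' : x'.1 + Pi.single μ 1 ∈ boxDom (N0 ℓ Mh k P)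

/-- pairs are determined by their two points. [folklore] -/
private theorem HPair.ext' {D : Domains d ℓ Mh k P R} {μ : Fin (d + 1)} {p q : HPair D μ} (hx : p.x = q.x) (hx' : p.x' = q.x') :
    p = q := by
  cases p; cases q
  simp only at hx hx'
  subst hx hx'
  rfl

/-- finitely many pairs (they embed into pairs of box sites). [cite: Balaban1984PropagatorsII, (2.67) p.234, dictionary] -/
instance instFiniteHPair (D : Domains d ℓ Mh k P R) (μ : Fin (d + 1)) : Finite (HPair D μ) :=
  Finite.of_injective (fun p : HPair D μ => (p.x, p.x')) fun p q h => by
    simp only [Prod.mk.injEq] at h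
    exact HPair.ext' h.1 h.2

/-- finitely many pairs. [cite: Balaban1984PropagatorsII, (2.67) p.234, dictionary] -/
noncomputable instance instFintypeHPair (D : Domains d ℓ Mh k P R) (μ : Fin (d + 1)) : Fintype (HPair D μ) :=
  Fintype.ofFinite _

/-- equality of pairs is decidable (classically). [cite: Balaban1984PropagatorsII, (2.67) p.234, dictionary] -/
noncomputable instance instDecidableEqHPair (D : Domains d ℓ Mh k P R) (μ : Fin (d + 1)) :
    DecidableEq (HPair D μ) :=
  Classical.decEq _

/-- the block of a pair (that of both its points, `y^j(x)`). [cite: Balaban1984PropagatorsII, p.231, dictionary] -/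
def blkP (D : Domains d ℓ Mh k P R) (μ : Fin (d + 1)) : HPair D μ → ↥(bset D) := fun p => blkOf D p.x

/-- **THE HÖLDER-WEIGHTED MIXED DIFFERENCE OVER A PAIR** (lattice units):
`(Dd f)(x, x′) = |x′ − x|_∞^{−α}·((f(x′+e_μ) − f(x′)) − (f(x+e_μ) − f(x)))`. [cite: Balaban1984PropagatorsII, (2.67) p.234 (fourth entry ‖ζ∇^η_xG′λ‖_α), dictionary] -/
def Dd (D : Domains d ℓ Mh k P R) (μ : Fin (d + 1)) (α : ℝ) : (↥(boxDom (N0 ℓ Mh k P)) → ℝ) →ₗ[ℝ] (HPair D μ → ℝ) where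
  toFun f p := (supNorm (p.x'.1 - p.x.1)) ^ (-α)
    * ((f ⟨p.x'.1 + Pi.single μ 1, p.hxe'⟩ - f p.x') - (f ⟨p.x.1 + Pi.single μ 1, p.hxe⟩ - f p.x))
  map_add' f f' := by
    funext p
    simp only [Pi.add_apply]
    ring
  map_smul' r f := by
    funext p
    simp only [Pi.smul_apply, smul_eq_mul, RingHom.id_apply]
    ring

/-- values of `Dd`. [cite: Balaban1984PropagatorsII, (2.67) p.234 (fourth entry), dictionary] -/
theorem Dd_apply (D : B6MultiLevelBoxOperatorL0.Domains d ℓ Mh k P R) (μ : Fin (d + 1)) (α : ℝ) (f : ↥(boxDom (N0 ℓ Mh k P)) → ℝ)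
    (p : HPair D μ) :
    Dd D μ α f p = (supNorm (p.x'.1 - p.x.1)) ^ (-α)
      * ((f ⟨p.x'.1 + Pi.single μ 1, p.hxe'⟩ - f p.x') - (f ⟨p.x.1 + Pi.single μ 1, p.hxe⟩ - f p.x)) := rfl

/-- **THE FUNCTIONAL OF THE FOURTH ENTRY** applied to a kernel `M`: `T(M) = Dd ∘ M`. [cite: Balaban1984PropagatorsII, (2.67) p.234 (fourth entry), dictionary] -/
def holderOp (D : Domains d ℓ Mh k P R) (μ : Fin (d + 1)) (α : ℝ)
    (M : Matrix ↥(boxDom (N0 ℓ Mh k P)) ↥(boxDom (N0 ℓ Mh k P)) ℝ) :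
    (↥(boxDom (N0 ℓ Mh k P)) → ℝ) →ₗ[ℝ] (HPair D μ → ℝ) :=
  Dd D μ α ∘ₗ Matrix.toLin' M

/-- values of `holderOp`. [cite: Balaban1984PropagatorsII, (2.67) p.234 (fourth entry), dictionary] -/
theorem holderOp_apply (D : B6MultiLevelBoxOperatorL0.Domains d ℓ Mh k P R) (μ : Fin (d + 1)) (α : ℝ)
    (M : Matrix ↥(boxDom (N0 ℓ Mh k P)) ↥(boxDom (N0 ℓ Mh k P)) ℝ) (f : ↥(boxDom (N0 ℓ Mh k P)) → ℝ)
    (p : HPair D μ) :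
    holderOp D μ α M f p = (supNorm (p.x'.1 - p.x.1)) ^ (-α)
      * (((M *ᵥ f) ⟨p.x'.1 + Pi.single μ 1, p.hxe'⟩ - (M *ᵥ f) p.x') - ((M *ᵥ f) ⟨p.x.1 + Pi.single μ 1, p.hxe⟩
        - (M *ᵥ f) p.x)) := by
  unfold holderOp
  rw [LinearMap.comp_apply, Matrix.toLin'_apply, Dd_apply]

/-- `T(M + M′) = T(M) + T(M′)`. [cite: Balaban1984PropagatorsII, (2.67) p.234 (fourth entry), dictionary] -/
theorem holderOp_add (D : B6MultiLevelBoxOperatorL0.Domains d ℓ Mh k P R) (μ : Fin (d + 1)) (α : ℝ)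
    (M M' : Matrix ↥(boxDom (N0 ℓ Mh k P)) ↥(boxDom (N0 ℓ Mh k P)) ℝ) :
    holderOp D μ α (M + M') = holderOp D μ α M + holderOp D μ α M' := by
  unfold holderOp
  rw [map_add, LinearMap.comp_add]

/-- `T(M·M′) = T(M) ∘ M′`. [cite: Balaban1984PropagatorsII, (2.67) p.234 (fourth entry), dictionary] -/
theorem holderOp_mul (D : B6MultiLevelBoxOperatorL0.Domains d ℓ Mh k P R) (μ : Fin (d + 1)) (α : ℝ)
    (M M' : Matrix ↥(boxDom (N0 ℓ Mh k P)) ↥(boxDom (N0 ℓ Mh k P)) ℝ) :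
    holderOp D μ α (M * M') = holderOp D μ α M ∘ₗ Matrix.toLin' M' := by
  unfold holderOp
  rw [Matrix.toLin'_mul, LinearMap.comp_assoc]

/-- **THE LIFTED FIXED POINT OF THE FOURTH ENTRY**: with `T = Dd∘G′`, `T₀ = Dd∘G′₀`:
`liftL T = liftL T₀ + liftL T · liftR R` (from `G′ = G′₀ + G′R`, (2.38)/(2.50)). [cite: Balaban1984PropagatorsII, (2.38) p.229, (2.50) p.232, (2.66)–(2.67) p.234] -/
theorem fixedPoint_holder (D : Domains d ℓ Mh k P R) {a c : ℕ → ℝ} (hℓ : 1 ≤ ℓ) (hR : 2 * (ℓ + 1) ≤ R)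
    (hP : ∀ μ, 1 ≤ P μ) (hMh : 2 ≤ Mh) (ha : ∀ i, 0 < a i) (hcpos : ∀ i, 0 < c i)
    (hac : ∀ i, a (i + 1) = aNext ℓ (a i) (c i)) (μ : Fin (d + 1)) (α : ℝ) :
    liftL (holderOp D μ α (gml (N0 ℓ Mh k P) ℓ k D.lev a))
      = liftL (holderOp D μ α (gZeroML D a c hP))
        + liftL (holderOp D μ α (gml (N0 ℓ Mh k P) ℓ k D.lev a)) * liftR (Matrix.toLin' (rML D a c hP)) := by
  have h238 := eq238_multiLevelBox (D := D) (a := a) (c := c) hℓ hR hP hMh ha hcpos hac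
  have hGE : gml (N0 ℓ Mh k P) ℓ k D.lev a * mlOp (N0 ℓ Mh k P) ℓ k D.lev a = 1 :=
    gml_mul_mlOp (fun ν => Nat.one_le_iff_ne_zero.2 (by have := hP ν; have := hMh; positivity)) D.lev_le ha
  have hmat : gml (N0 ℓ Mh k P) ℓ k D.lev a
      = gZeroML D a c hP + gml (N0 ℓ Mh k P) ℓ k D.lev a * rML D a c hP := by
    have h := congrArg (fun T => gml (N0 ℓ Mh k P) ℓ k D.lev a * T) h238
    rw [← Matrix.mul_assoc, hGE, Matrix.one_mul, Matrix.mul_sub, Matrix.mul_one] at h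
    rw [h]; abel
  conv_lhs => rw [hmat]
  rw [holderOp_add, holderOp_mul, liftL_add, liftL_mul_liftR]

end Pairs

/-! ## §3 The pair-row bound of `T₀ = Dd∘G′₀`: the sum over the cover -/

section ZeroBound

variable {ℓ Mh k R : ℕ} {P : Fin (d + 1) → ℕ}

/-- the value of a cube term vanishes where its cut-off does. [cite: Balaban1984PropagatorsII, (2.37) p.229, dictionary] -/
private theorem aX_apply_eq_zero {D : Domains d ℓ Mh k P R} {a c : ℕ → ℝ} (hP : ∀ μ, 1 ≤ P μ)
    (cq : ℕ × (Fin (d + 1) → ℤ)) (hc : CubeData D cq)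
    (lam : ↥(boxDom (N0 ℓ Mh k P)) → ℝ) {z : ↥(boxDom (N0 ℓ Mh k P))}
    (hz : uX (ℓ := ℓ) (Mh := Mh) (k := k) (P := P) cq z = 0) : (aX D a c hP cq hc *ᵥ lam) z = 0 := by
  rw [aX_mulVec_apply, hz, zero_mul]

/-- **THE (2.64)-INPUT FOR THE FOURTH ENTRY, GENUINE `k`-LEVEL OPERATOR**: there are `δ₅, A > 0` (functions of
`d`, `ℓ`, `α`, the windows) such that for every `k`, `M_h ≥ 3`, `R ≥ 2L`, volume, nested family `D`, weights in the
windows, axis `μ`, every `λ` supported in a block `y′` with `|λ| ≤ B` and every pair `(x, x′)` of one block `B^j(y)`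
(`x ≠ x′`, `x + e_μ`, `x′ + e_μ` in the box):
`|x′−x|_∞^{−α}·|((G′₀λ)(x′+e_μ) − (G′₀λ)(x′)) − ((G′₀λ)(x+e_μ) − (G′₀λ)(x))| ≤ A·(L^{j})^{1−α}·e^{−δ₅d(y,y′)/(d+1)}·|λ|`
— the terms of `G′₀ = Σ_□ h_□G′(□)v_□` one by one (file 10 `aX_dd_le`), at most `12·2^{d+1}` of them meeting the four points.
[cite: Balaban1984PropagatorsII, (2.64)–(2.66) p.234 (the G′₀ factor «(L^jη)^{1−α}» of the Hölder entry), (2.43) p.230] -/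
theorem holderZero_rowBound (d ℓ : ℕ) (hℓ : 1 ≤ ℓ) (aminus aplus a2minus a2plus : ℝ) (ha : 0 < aminus)
    (ha2 : 0 < a2minus) (α : ℝ) (hα0 : 0 ≤ α) (hα1 : α < 1) :
    ∃ δ₅ A : ℝ, 0 < δ₅ ∧ 0 < A ∧ ∀ (k Mh R : ℕ), 3 ≤ Mh → 2 * (ℓ + 1) ≤ R →
      ∀ (P : Fin (d + 1) → ℕ) (hP : ∀ μ, 1 ≤ P μ) (D : Domains d ℓ Mh k P R) (a c : ℕ → ℝ),
        (∀ i, aminus ≤ a i ∧ a i ≤ aplus) → (∀ i, a2minus ≤ c i ∧ c i ≤ a2plus) →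
        ∀ (μ : Fin (d + 1)) (y' : ↥(bset D)) (lam : ↥(boxDom (N0 ℓ Mh k P)) → ℝ) (B : ℝ),
          BlockSupp (g := geom D) (blkOf D) lam y' B → ∀ p : HPair D μ,
          |holderOp D μ α (gZeroML D a c hP) lam p|
            ≤ A * (((ℓ : ℝ) + 1) ^ (blkP D μ p).1.1) ^ (1 - α)
              * Real.exp (-(δ₅ / (d + 1) * (geom D).dist (blkP D μ p) y')) * B := by
  obtain ⟨δ₄, Q, hδ₄, hQ, hterm⟩ := aX_dd_le d ℓ hℓ aminus aplus a2minus a2plus ha ha2 α hα0 hα1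
  refine ⟨δ₄, 12 * 2 ^ (d + 1) * Q + 1, hδ₄, by positivity, ?_⟩
  intro k Mh R hMh hR P hP D a c haw hcw μ y' lam B hlam p
  have hMh1 : 1 ≤ Mh := le_trans (by norm_num) hMh
  have hMh2 : 2 ≤ Mh := le_trans (by norm_num) hMh
  have hB0 : 0 ≤ B := hlam.nonneg
  have hlev : (blkP D μ p).1.1 = D.lev p.x.1 := rfl
  have hblkP : blkP D μ p = blkOf D p.x := rfl
  rw [hlev, hblkP]
  obtain ⟨E4, hE4⟩ : ∃ t : ℝ, t = Real.exp (-(δ₄ / (d + 1) * (geom D).dist (blkOf D p.x) y')) := ⟨_, rfl⟩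
  obtain ⟨LJ, hLJ⟩ : ∃ t : ℝ, t = (((ℓ : ℝ) + 1) ^ D.lev p.x.1) ^ (1 - α) := ⟨_, rfl⟩
  rw [← hE4, ← hLJ]
  have hE40 : 0 ≤ E4 := by rw [hE4]; exact (Real.exp_pos _).le
  have hLJ0 : 0 ≤ LJ := by rw [hLJ]; exact Real.rpow_nonneg (by positivity) _
  have hs0 : 0 < supNorm (p.x'.1 - p.x.1) :=
    lt_of_lt_of_le one_pos (B4StripSumsHolder.one_le_supNorm (sub_ne_zero.2 p.ne))
  have hW0 : 0 ≤ (supNorm (p.x'.1 - p.x.1)) ^ (-α) := Real.rpow_nonneg hs0.le _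
  -- one term
  obtain ⟨E, hE⟩ : ∃ t : ℝ, t = LJ * (Q * E4 * B) := ⟨_, rfl⟩
  have hEnn : 0 ≤ E := by rw [hE]; positivity
  have hone : ∀ (cq : ℕ × (Fin (d + 1) → ℤ)) (hc : CubeData D cq),
      |(supNorm (p.x'.1 - p.x.1)) ^ (-α)
        * (((aX D a c hP cq hc *ᵥ lam) ⟨p.x'.1 + Pi.single μ 1, p.hxe'⟩ - (aX D a c hP cq hc *ᵥ lam) p.x')
          - ((aX D a c hP cq hc *ᵥ lam) ⟨p.x.1 + Pi.single μ 1, p.hxe⟩ - (aX D a c hP cq hc *ᵥ lam) p.x))| ≤ E := by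
    intro cq hc
    rw [abs_mul, abs_of_nonneg hW0, hE, hLJ, hE4]
    exact hterm k Mh R hMh hR P hP D a c haw hcw μ y' lam B hlam p.x p.x' p.ne p.blk p.hxe p.hxe' cq hc
  -- the sum over the cover
  rw [holderOp_apply]
  unfold gZeroML
  rw [Matrix.sum_mulVec, Finset.sum_apply, Finset.sum_apply, Finset.sum_apply, Finset.sum_apply,
    ← Finset.sum_sub_distrib, ← Finset.sum_sub_distrib, ← Finset.sum_sub_distrib, Finset.mul_sum, Finset.attach_eq_univ]
  refine (Finset.abs_sum_le_sum_abs _ _).trans ?_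
  -- the members with a non-zero term: `h_□ ≠ 0` at one of the four points
  obtain ⟨xe, hxedef⟩ : ∃ t : ↥(boxDom (N0 ℓ Mh k P)), t = ⟨p.x.1 + Pi.single μ 1, p.hxe⟩ := ⟨_, rfl⟩
  obtain ⟨xe', hxe'def⟩ : ∃ t : ↥(boxDom (N0 ℓ Mh k P)), t = ⟨p.x'.1 + Pi.single μ 1, p.hxe'⟩ := ⟨_, rfl⟩
  obtain ⟨T, hTsub, hTcard⟩ : ∃ T : Finset (ℕ × (Fin (d + 1) → ℤ)),
      (∀ cq, (cq ∈ keySet ℓ Mh (D.lev p.x.1) p.x.1 ∨ cq ∈ keySet ℓ Mh (D.lev xe.1) xe.1)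
        ∨ (cq ∈ keySet ℓ Mh (D.lev p.x'.1) p.x'.1 ∨ cq ∈ keySet ℓ Mh (D.lev xe'.1) xe'.1) → cq ∈ T)
        ∧ (T.card : ℝ) ≤ 12 * 2 ^ (d + 1) := by
    refine ⟨(keySet ℓ Mh (D.lev p.x.1) p.x.1 ∪ keySet ℓ Mh (D.lev xe.1) xe.1)
      ∪ (keySet ℓ Mh (D.lev p.x'.1) p.x'.1 ∪ keySet ℓ Mh (D.lev xe'.1) xe'.1), fun cq h => ?_, ?_⟩
    · simp only [Finset.mem_union]; exact h
    · have h1 := card_keySet_le ℓ Mh (D.lev p.x.1) p.x.1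
      have h2 := card_keySet_le ℓ Mh (D.lev xe.1) xe.1
      have h3 := card_keySet_le ℓ Mh (D.lev p.x'.1) p.x'.1
      have h4 := card_keySet_le ℓ Mh (D.lev xe'.1) xe'.1
      have u1 := Finset.card_union_le (keySet ℓ Mh (D.lev p.x.1) p.x.1) (keySet ℓ Mh (D.lev xe.1) xe.1)
      have u2 := Finset.card_union_le (keySet ℓ Mh (D.lev p.x'.1) p.x'.1) (keySet ℓ Mh (D.lev xe'.1) xe'.1)
      have u3 := Finset.card_union_le (keySet ℓ Mh (D.lev p.x.1) p.x.1 ∪ keySet ℓ Mh (D.lev xe.1) xe.1)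
        (keySet ℓ Mh (D.lev p.x'.1) p.x'.1 ∪ keySet ℓ Mh (D.lev xe'.1) xe'.1)
      have h5 : ((keySet ℓ Mh (D.lev p.x.1) p.x.1 ∪ keySet ℓ Mh (D.lev xe.1) xe.1)
          ∪ (keySet ℓ Mh (D.lev p.x'.1) p.x'.1 ∪ keySet ℓ Mh (D.lev xe'.1) xe'.1)).card ≤ 12 * 2 ^ (d + 1) := by
        omega
      exact_mod_cast h5
  rw [← hxedef, ← hxe'def] at hone ⊢
  have key := sum_le_card_mul
    (fun cq : {cq // cq ∈ cubeSet D} => |(supNorm (p.x'.1 - p.x.1)) ^ (-α)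
        * (((aX D a c hP cq.1 (cubeData_of_mem cq.2) *ᵥ lam) xe' - (aX D a c hP cq.1 (cubeData_of_mem cq.2) *ᵥ lam) p.x')
          - ((aX D a c hP cq.1 (cubeData_of_mem cq.2) *ᵥ lam) xe - (aX D a c hP cq.1 (cubeData_of_mem cq.2) *ᵥ lam) p.x))|)
    (fun cq => cq.1) Subtype.val_injective T
    (fun cq hq0 => by
      by_contra hmem
      apply hq0
      have hux : uX (ℓ := ℓ) (Mh := Mh) (k := k) (P := P) cq.1 p.x = 0 := by
        by_contra h
        exact hmem (hTsub _ (Or.inl (Or.inl (mem_keySet_of_uX_ne_zero hℓ hR hP hMh2 cq.1 (cubeData_of_mem cq.2) h))))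
      have huxe : uX (ℓ := ℓ) (Mh := Mh) (k := k) (P := P) cq.1 xe = 0 := by
        by_contra h
        exact hmem (hTsub _ (Or.inl (Or.inr (mem_keySet_of_uX_ne_zero hℓ hR hP hMh2 cq.1 (cubeData_of_mem cq.2) h))))
      have hux' : uX (ℓ := ℓ) (Mh := Mh) (k := k) (P := P) cq.1 p.x' = 0 := by
        by_contra h
        exact hmem (hTsub _ (Or.inr (Or.inl (mem_keySet_of_uX_ne_zero hℓ hR hP hMh2 cq.1 (cubeData_of_mem cq.2) h))))
      have huxe' : uX (ℓ := ℓ) (Mh := Mh) (k := k) (P := P) cq.1 xe' = 0 := by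
        by_contra h
        exact hmem (hTsub _ (Or.inr (Or.inr (mem_keySet_of_uX_ne_zero hℓ hR hP hMh2 cq.1 (cubeData_of_mem cq.2) h))))
      rw [aX_apply_eq_zero hP cq.1 _ lam hux, aX_apply_eq_zero hP cq.1 _ lam huxe,
        aX_apply_eq_zero hP cq.1 _ lam hux', aX_apply_eq_zero hP cq.1 _ lam huxe']
      simp only [sub_self, mul_zero, abs_zero])
    hEnn (fun cq => hone cq.1 (cubeData_of_mem cq.2))
  refine key.trans ?_
  calc (T.card : ℝ) * E ≤ 12 * 2 ^ (d + 1) * E := mul_le_mul_of_nonneg_right hTcard hEnn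
    _ = 12 * 2 ^ (d + 1) * Q * LJ * E4 * B := by rw [hE]; ring
    _ ≤ (12 * 2 ^ (d + 1) * Q + 1) * LJ * E4 * B := by
        have : 0 ≤ LJ * E4 * B := by positivity
        nlinarith
    _ = (12 * 2 ^ (d + 1) * Q + 1) * LJ * E4 * B := rfl

end ZeroBound

/-! ## §4 Proposition 2.2, fourth entry, for the genuine `k`-level operator -/

section Prop22

variable {ℓ Mh k R : ℕ} {P : Fin (d + 1) → ℕ}

/-- **THE LIFTED FOURTH ENTRY HAS A MAJORANT** `C·(L^{j})^{1−α}·e^{−½δ₀d(y,y′)}` on `𝔅` (pairs of `B^j(y)` as rows):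
for `0 ≤ α < 1` there are `δ₀, C, M₀ > 0`, `N₀ ≥ 1` (functions of `d`, `ℓ`, `α`, the windows) such that for every `k`,
`M_h ≥ 3` with `L·M_h ≥ M₀`, `R ≥ 2L` with `RM ≥ N₀ + 1`, volume, nested family `D`, weights in the windows with
`a_{i+1} = aNext ℓ a_i c_i` and axis `μ`, the lift of `T = Dd∘G′` (`G′ = Δ′_a^{−1}`) has that majorant — the lifted
fixed point `T = T₀ + T·R` (§2), the majorants of `R` ((2.64), file 5) and of `T₀` (§3), Lemma 2.1 on the box (file 4)
and the chain (2.64)–(2.66) (`B6Prop23Chain.majorant_of_fixedPoint_266W`) on the index set `pairs ⊕ sites`.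
[cite: Balaban1984PropagatorsII, Proposition 2.2 (2.67) p.234 (fourth entry), (2.64)–(2.66) p.234] -/
theorem hasMajorant_holder_multiLevelBox (d ℓ : ℕ) (hℓ : 1 ≤ ℓ) (aminus aplus a2minus a2plus : ℝ) (ha : 0 < aminus)
    (ha2 : 0 < a2minus) (α : ℝ) (hα0 : 0 ≤ α) (hα1 : α < 1) :
    ∃ δ₀ C M₀ : ℝ, ∃ N₀ : ℕ, 0 < δ₀ ∧ 0 < C ∧ 0 < M₀ ∧ 0 < N₀ ∧
      ∀ (k Mh R : ℕ), 3 ≤ Mh → M₀ ≤ ((ℓ : ℝ) + 1) * Mh → 2 * (ℓ + 1) ≤ R → N₀ + 1 ≤ R * ((ℓ + 1) * Mh) →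
      ∀ (P : Fin (d + 1) → ℕ) (hP : ∀ μ, 1 ≤ P μ) (D : Domains d ℓ Mh k P R) (a c : ℕ → ℝ),
        (∀ i, aminus ≤ a i ∧ a i ≤ aplus) → (∀ i, a2minus ≤ c i ∧ c i ≤ a2plus) →
        (∀ i, a (i + 1) = aNext ℓ (a i) (c i)) → ∀ μ : Fin (d + 1),
        HasMajorant (g := geom D) (Sum.elim (blkP D μ) (blkOf D))
          (liftL (holderOp D μ α (gml (N0 ℓ Mh k P) ℓ k D.lev a)))
          (fun y y' => C * (((ℓ : ℝ) + 1) ^ y.1.1) ^ (1 - α) * Real.exp (-(δ₀ / 2 * (geom D).dist y y'))) := by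
  obtain ⟨δ₁, K, hδ₁, hK, hRmaj⟩ := rML_majorant d ℓ hℓ aminus aplus a2minus a2plus ha ha2
  obtain ⟨δ₂, A, hδ₂, hA, hGrow⟩ := holderZero_rowBound d ℓ hℓ aminus aplus a2minus a2plus ha ha2 α hα0 hα1
  have hL0 : (0 : ℝ) < (ℓ : ℝ) + 1 := by positivity
  have hL1 : (1 : ℝ) ≤ (ℓ : ℝ) + 1 := by linarith [(Nat.cast_nonneg ℓ : (0 : ℝ) ≤ ℓ)]
  -- the rate `δ₀ = min(δ₁, δ₂)/(d+1)` and the (2.59)-threshold `N₀`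
  set δ₀ : ℝ := min δ₁ δ₂ / (d + 1) with hδ₀
  have hδ₀pos : 0 < δ₀ := by rw [hδ₀]; exact div_pos (lt_min hδ₁ hδ₂) (by positivity)
  set N₀ : ℕ := ⌈4 * ((d : ℝ) + 1) * ((ℓ : ℝ) + 1) / (1 / 2 * δ₀)⌉₊ + 1 with hN₀
  have hN₀pos : 0 < N₀ := by rw [hN₀]; omega
  have hθlt : Real.exp (-(1 / 2 * δ₀)) * ((ℓ : ℝ) + 1) ^ ((2 * (d + 1 : ℕ) : ℝ) / N₀) < 1 := by
    refine theta_lt_one_of_log hL0 hN₀pos ?_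
    have hlog : Real.log ((ℓ : ℝ) + 1) ≤ (ℓ : ℝ) + 1 := (Real.log_le_sub_one_of_pos hL0).trans (by linarith)
    have hN₀ge : 4 * ((d : ℝ) + 1) * ((ℓ : ℝ) + 1) / (1 / 2 * δ₀) < (N₀ : ℝ) := by
      rw [hN₀]; push_cast
      exact lt_of_le_of_lt (Nat.le_ceil _) (by linarith)
    have hσ : (0 : ℝ) < 1 / 2 * δ₀ := by positivity
    rw [div_lt_iff₀ hσ] at hN₀ge
    push_cast
    nlinarith [mul_nonneg (by positivity : (0 : ℝ) ≤ 2 * ((d : ℝ) + 1)) (Real.log_nonneg hL1)]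
  -- the (2.61)-constant and «M sufficiently large»
  set cK : ℝ := K261 N₀ (d + 1) ((ℓ : ℝ) + 1) 1 (1 / 2 * δ₀) with hcK
  have hcK0 : 0 ≤ cK := K261_nonneg (by positivity) zero_le_one
  set M₀ : ℝ := 2 * K * cK + 1 with hM₀
  refine ⟨δ₀, 2 * A * cK + 1, M₀, N₀, hδ₀pos, by positivity, by positivity, hN₀pos, ?_⟩
  intro k Mh R hMh hM hR hRM P hP D a c haw hcw hac μ
  have hMh1 : 1 ≤ Mh := le_trans (by norm_num) hMh
  have hMh2 : 2 ≤ Mh := le_trans (by norm_num) hMh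
  have hMpos : (0 : ℝ) < ((ℓ : ℝ) + 1) * Mh := by
    have : (1 : ℝ) ≤ Mh := by exact_mod_cast hMh1
    positivity
  -- the majorants of the lifted `R` and of the lifted `T₀`, at the common rate `δ₀`
  set θ : ℝ := K / (((ℓ : ℝ) + 1) * Mh) with hθ
  have hθ0 : 0 ≤ θ := by positivity
  have hdnn : ∀ y y' : (geom D).Site, 0 ≤ (geom D).dist y y' := (triangle_refl_nonneg D hMh1 hP).2.2
  have hrate : ∀ (δ : ℝ), min δ₁ δ₂ ≤ δ → ∀ y y' : (geom D).Site,
      Real.exp (-(δ / (d + 1) * (geom D).dist y y')) ≤ Real.exp (-(δ₀ * (geom D).dist y y')) := by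
    intro δ hδ y y'
    rw [Real.exp_le_exp, hδ₀, neg_le_neg_iff]
    exact mul_le_mul_of_nonneg_right (div_le_div_of_nonneg_right hδ (by positivity)) (hdnn y y')
  have hRm0 : HasMajorant (g := geom D) (blkOf D) (Matrix.toLin' (rML D a c hP))
      (fun y y' => θ * Real.exp (-(δ₀ * (geom D).dist y y'))) :=
    hasMajorant_mono (blkOf D) (hRmaj k Mh R hMh hR P hP D a c haw hcw) fun y y' =>
      mul_le_mul_of_nonneg_left (hrate δ₁ (min_le_left _ _) y y') hθ0
  have hRm : HasMajorant (g := geom D) (Sum.elim (blkP D μ) (blkOf D))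
      (liftR (Y := HPair D μ) (Matrix.toLin' (rML D a c hP)))
      (fun y y' => θ * Real.exp (-(δ₀ * (geom D).dist y y'))) :=
    hasMajorant_liftR (g := geom D) (blkOf D) (blkP D μ) (K := fun y y' => θ * Real.exp (-(δ₀ * (geom D).dist y y')))
      (fun y y' => by positivity) hRm0
  have hGm : HasMajorant (g := geom D) (Sum.elim (blkP D μ) (blkOf D))
      (liftL (holderOp D μ α (gZeroML D a c hP)))
      (fun y y' => A * (((ℓ : ℝ) + 1) ^ y.1.1) ^ (1 - α) * Real.exp (-(δ₀ * (geom D).dist y y'))) := by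
    refine hasMajorant_liftL (g := geom D) (blkOf D) (blkP D μ)
      (K := fun y y' => A * (((ℓ : ℝ) + 1) ^ y.1.1) ^ (1 - α) * Real.exp (-(δ₀ * (geom D).dist y y')))
      (fun y y' => by positivity) fun y' lam B hlam p => ?_
    refine (hGrow k Mh R hMh hR P hP D a c haw hcw μ y' lam B hlam p).trans ?_
    refine mul_le_mul_of_nonneg_right ?_ hlam.nonneg
    exact mul_le_mul_of_nonneg_left (hrate δ₂ (min_le_right _ _) _ _) (by positivity)
  -- Lemma 2.1 on the box with `α′ = ½`
  obtain ⟨-, h261, -, h263⟩ := lemma21_box D hMh1 hP hN₀pos hRM hδ₀pos.le (α := 1 / 2) (by norm_num)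
    (by norm_num) hθlt
  obtain ⟨htri, hrefl, -⟩ := triangle_refl_nonneg D hMh1 hP
  -- the smallness `θ·c < 1` from `M ≥ M₀`
  have hsmall : θ * cK ≤ 1 / 2 := by
    rw [hθ, div_mul_eq_mul_div, div_le_iff₀ hMpos]
    have : 2 * K * cK + 1 ≤ ((ℓ : ℝ) + 1) * Mh := hM
    nlinarith
  have hsmall' : θ * cK < 1 := by linarith
  -- the lifted fixed point and the chain on `pairs ⊕ sites`
  have hfix := fixedPoint_holder D (c := c) hℓ hR hP hMh2 (fun i => lt_of_lt_of_le ha (haw i).1)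
    (fun i => lt_of_lt_of_le ha2 (hcw i).1) hac μ α
  have hchain := majorant_of_fixedPoint_266W (g := geom D) (Sum.elim (blkP D μ) (blkOf D)) cK δ₀ (1 / 2) θ A
    (fun y => (((ℓ : ℝ) + 1) ^ y.1.1) ^ (1 - α)) hA.le (fun y => Real.rpow_nonneg (by positivity) _) hθ0 hcK0
    (by nlinarith [hδ₀pos.le] : (0 : ℝ) ≤ (1 - 1 / 2) * δ₀) htri hrefl hdnn h261 h263 hsmall' hGm hRm hfix
  refine hasMajorant_mono (g := geom D) (Sum.elim (blkP D μ) (blkOf D)) hchain fun y y' => ?_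
  have hinv : (1 - θ * cK)⁻¹ ≤ 2 := by
    rw [inv_le_comm₀ (by linarith) (by norm_num)]; linarith
  have hexp0 : 0 ≤ Real.exp (-((1 - 1 / 2) * δ₀ * (geom D).dist y y')) := (Real.exp_pos _).le
  have hP0 : 0 ≤ (((ℓ : ℝ) + 1) ^ y.1.1) ^ (1 - α) := Real.rpow_nonneg (by positivity) _
  have hrate2 : Real.exp (-((1 - 1 / 2) * δ₀ * (geom D).dist y y')) = Real.exp (-(δ₀ / 2 * (geom D).dist y y')) := by
    congr 1; ring
  rw [← hrate2]
  have h1 : A * cK * (1 - θ * cK)⁻¹ ≤ 2 * A * cK + 1 := by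
    have : A * cK * (1 - θ * cK)⁻¹ ≤ A * cK * 2 := mul_le_mul_of_nonneg_left hinv (by positivity)
    linarith
  calc A * cK * (1 - θ * cK)⁻¹ * (((ℓ : ℝ) + 1) ^ y.1.1) ^ (1 - α) * Real.exp (-((1 - 1 / 2) * δ₀ * (geom D).dist y y'))
      = A * cK * (1 - θ * cK)⁻¹
        * ((((ℓ : ℝ) + 1) ^ y.1.1) ^ (1 - α) * Real.exp (-((1 - 1 / 2) * δ₀ * (geom D).dist y y'))) := by ring
    _ ≤ (2 * A * cK + 1) * ((((ℓ : ℝ) + 1) ^ y.1.1) ^ (1 - α) * Real.exp (-((1 - 1 / 2) * δ₀ * (geom D).dist y y'))) :=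
        mul_le_mul_of_nonneg_right h1 (mul_nonneg hP0 hexp0)
    _ = (2 * A * cK + 1) * (((ℓ : ℝ) + 1) ^ y.1.1) ^ (1 - α) * Real.exp (-((1 - 1 / 2) * δ₀ * (geom D).dist y y')) := by
        ring

/-- **[B6] PROPOSITION 2.2, FOURTH ENTRY OF (2.67) (`‖ζ∇^η_xG′λ‖_α`), FOR THE GENUINE `k`-LEVEL OPERATOR
`G′ = Δ′_a^{−1}` ON A BOX**: for `0 ≤ α < 1` there are `δ₀, C, M₀ > 0` and `N₀ ≥ 1` (functions of `d`, `ℓ`, `α`, the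
windows) such that for EVERY number of levels `k`, `M_h ≥ 3` with `L·M_h ≥ M₀` («M is sufficiently large»), `R ≥ 2L`
with `RM ≥ N₀ + 1` ((2.59)), volume `P`, nested family `D` of domains (2.1)–(2.2), weights `a_i ∈ [a₋, a₊]`,
`c_i ∈ [c₋, c₊]` with `a_{i+1} = aNext ℓ a_i c_i`, axis `μ`, and all `x ≠ x′` of one block `B^j(y)`, `y ∈ Λ_j`, with
`x + e_μ`, `x′ + e_μ` in the box:
`|x′−x|_∞^{−α}·|((G′λ)(x′+e_μ) − (G′λ)(x′)) − ((G′λ)(x+e_μ) − (G′λ)(x))| ≤ C·(L^{j})^{1−α}·e^{−½δ₀d(y,y′)}·|λ|`,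
`supp λ ⊂ B^{j′}(y′)` (lattice units: `G′` is `η^{−2}G′` of print and the difference is `η∇^η`, whence `(L^{j})^{1−α}`
for «(L^jη)^{1−α}»; the Hölder quotient of `∇^η_μG′λ` over the pairs of `B^j(y)`, the cut-off `ζ` and the factor
`(‖ζ‖_α + |ζ|)` of print being dispensed with as in [3] (1.9)) — by the printed route: `∇G′ = ∇G′₀ + (∇G′)R`
differenced over pairs, the majorants of `R` ((2.64)) and of the pair rows of `∇G′₀` (§3), Lemma 2.1 and the chain
(2.64)–(2.66). [cite: Balaban1984PropagatorsII, Proposition 2.2 (2.67) p.234 (fourth entry «(L^jη)^{1−α}(‖ζ‖_α + |ζ|)»), (2.64)–(2.66) p.234; Balaban1983RegularityDecay, Theorem (1.9) p.573] -/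
theorem prop22_fourth_multiLevelBox (d ℓ : ℕ) (hℓ : 1 ≤ ℓ) (aminus aplus a2minus a2plus : ℝ) (ha : 0 < aminus)
    (ha2 : 0 < a2minus) (α : ℝ) (hα0 : 0 ≤ α) (hα1 : α < 1) :
    ∃ δ₀ C M₀ : ℝ, ∃ N₀ : ℕ, 0 < δ₀ ∧ 0 < C ∧ 0 < M₀ ∧ 0 < N₀ ∧
      ∀ (k Mh R : ℕ), 3 ≤ Mh → M₀ ≤ ((ℓ : ℝ) + 1) * Mh → 2 * (ℓ + 1) ≤ R → N₀ + 1 ≤ R * ((ℓ + 1) * Mh) →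
      ∀ (P : Fin (d + 1) → ℕ) (hP : ∀ μ, 1 ≤ P μ) (D : Domains d ℓ Mh k P R) (a c : ℕ → ℝ),
        (∀ i, aminus ≤ a i ∧ a i ≤ aplus) → (∀ i, a2minus ≤ c i ∧ c i ≤ a2plus) →
        (∀ i, a (i + 1) = aNext ℓ (a i) (c i)) →
        ∀ (μ : Fin (d + 1)) (y' : ↥(bset D)) (lam : ↥(boxDom (N0 ℓ Mh k P)) → ℝ) (B : ℝ),
          BlockSupp (g := geom D) (blkOf D) lam y' B →
          ∀ (x x' : ↥(boxDom (N0 ℓ Mh k P))), x'.1 ≠ x.1 → blkOf D x' = blkOf D x →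
          ∀ (hxe : x.1 + Pi.single μ 1 ∈ boxDom (N0 ℓ Mh k P)) (hxe' : x'.1 + Pi.single μ 1 ∈ boxDom (N0 ℓ Mh k P)),
            (supNorm (x'.1 - x.1)) ^ (-α)
                * |((gml (N0 ℓ Mh k P) ℓ k D.lev a *ᵥ lam) ⟨x'.1 + Pi.single μ 1, hxe'⟩
                      - (gml (N0 ℓ Mh k P) ℓ k D.lev a *ᵥ lam) x')
                    - ((gml (N0 ℓ Mh k P) ℓ k D.lev a *ᵥ lam) ⟨x.1 + Pi.single μ 1, hxe⟩
                      - (gml (N0 ℓ Mh k P) ℓ k D.lev a *ᵥ lam) x)|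
              ≤ C * (((ℓ : ℝ) + 1) ^ D.lev x.1) ^ (1 - α) * Real.exp (-(δ₀ / 2 * (geom D).dist (blkOf D x) y')) * B := by
  obtain ⟨δ₀, C, M₀, N₀, hδ₀, hC, hM₀, hN₀, h⟩ :=
    hasMajorant_holder_multiLevelBox d ℓ hℓ aminus aplus a2minus a2plus ha ha2 α hα0 hα1
  refine ⟨δ₀, C, M₀, N₀, hδ₀, hC, hM₀, hN₀, ?_⟩
  intro k Mh R hMh hM hR hRM P hP D a c haw hcw hac μ y' lam B hlam x x' hne hblk hxe hxe'
  have hmaj := h k Mh R hMh hM hR hRM P hP D a c haw hcw hac μ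
  have hrow := rowBound_of_hasMajorant_liftL (g := geom D) (blkOf D) (blkP D μ) hmaj y' lam B hlam
    (⟨x, x', hne, hblk, hxe, hxe'⟩ : HPair D μ)
  rw [holderOp_apply, abs_mul, abs_of_nonneg (Real.rpow_nonneg (supNorm_nonneg _) _)] at hrow
  exact hrow

end Prop22

end

end Literature.MathematicalPhysics.QuantumFieldTheory.Balaban1983to89.B6Prop22HolderMultiLevelBoxL0
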